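import Summits.HodgeConjecture.HodgeConjecture.Theses.PadicSemiregularLift
import Summits.HodgeConjecture.HodgeConjecture.Theses.TropicalCuspLift
import Summits.HodgeConjecture.HodgeConjecture.Theorems.HodgeAbelianVarieties.Negative.ExtremeCodimensions
import Summits.HodgeConjecture.HodgeConjecture.Theorems.PadicSemiregularLiftHodgeAbelianVarietiesPrymDefs
import Summits.HodgeConjecture.HodgeConjecture.Theorems.PadicSemiregularLiftHodgeAbelianVarietiesPrymSeedDefs
import Summits.HodgeConjecture.HodgeConjecture.Theorems.PadicSemiregularLiftHodgeAbelianVarietiesStubSpreadClosing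
import Summits.HodgeConjecture.HodgeConjecture.Theorems.PadicSemiregularLiftHodgeAbelianVarietiesStubDescendPrym
import Summits.HodgeConjecture.HodgeConjecture.Theorems.PadicSemiregularLiftHodgeAbelianVarietiesStubWeilSectorOffReach
import Summits.HodgeConjecture.HodgeConjecture.Theorems.PadicSemiregularLiftHodgeAbelianVarietiesStubWeilSectorSufficesCM
import Summits.HodgeConjecture.HodgeConjecture.Theorems.PadicSemiregularLiftHodgeAbelianVarietiesStubBlochSpread
import Summits.HodgeConjecture.HodgeConjecture.Theorems.PadicSemiregularLiftHodgeAbelianVarietiesStubClosingFacts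
import Literature.AlgebraicGeometry.HodgeTheory.BlochSemiregularSpread
import Literature.AlgebraicGeometry.HodgeTheory.WeilFamilyReach
import Literature.AlgebraicGeometry.HodgeTheory.LefschetzOneOneHolds
import Literature.AlgebraicGeometry.HodgeTheory.SmoothProjectiveCompactificationProofs
import Literature.AlgebraicGeometry.HodgeTheory.AlgebraicityLocusIUnionClosedProofs

/-!
# Skeleton line `prym-canonical-z3-split-seeds` for crux `HodgeAbelianVarieties` (stmt-HodgeConjecture-1333) — GEN 4 (lead c2, 2026-08-16, after wave 2; gen 2 = lead a3 after wave 1)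

Route `PadicSemiregularLift`, crux r4 (typed OUTPUT item)
`HodgeAbelianVarieties := ∀ A : AbelianVariety ℂ, HodgeConjectureFor A.dim A.X` — the Hodge conjecture
for every complex abelian variety (= the summit restricted to abelian varieties,
`Negative.iff_hodgeConjecture_restricted`, landed p70486, IMPORTED here).

## What changed from gen 2 (lead a3, sha f0724d3f…) — lead c2, cycle 1 (gen 3 → gen 4 after wave 2)

* GEN 4 (wave 2): STUB 2 SHRUNK TO THE ONE CONSUMED CELL `BlochSemiregularSpread 8 4` (worker A, p122864
  `Theorems/…StubBlochSpread.lean`: the cells `p ≤ 1 ∨ n ≤ 3 ∨ n ≤ p + 1` are THEOREMS — `blochSpread_cells_holds`, Lefschetz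
  `(1,1)` + hard Lefschetz + HC in dim ≤ 3 —, the full `∀ n p` follows from the interior cells `stub_blochSpread_of_interior`, and
  the composition only ever calls `(8,4)`: `prymSpread_of_seed_of_bloch84` below); STUB 3' SHRUNK TO ONE NAMED FACT
  `weilFamilyReach_hyperbolic` (worker B, p123553 `Theorems/…StubClosingFacts.lean`: `spreadClosing_of_weilFamilyReach_hyperbolic`
  — Deligne's partie fixe and Hironaka are NOT needed by this line: the W-engine runs on the Leray form fed with the theorem
  `deligne1968_invariantClass_fromTotalSpace_holds`). Typing audit of the seed package at (8,4) (worker A, Lean-checked): the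
  carriers of `IsBlochSemiregular i 8 4` are faithful (source `H³(P,Ω⁵)`, target `H³(Z, Λ³𝒩 ⊗ ω_P|_Z)`), neither vacuous nor
  automatic; `IsRegularImmersionOfCodim i 4`, the coheight clause and integrality hold for every integral lci codim-4 `Z` — so
  stub 1 is exactly the mathematical question F2/F3.
* STUB 3' SHRUNK FROM FIVE NAMED FACTS TO TWO: three of the five closing facts are now THEOREMS of the tree —
  `Hironaka1964_smoothCompactification_holds` (`HodgeTheory/SmoothProjectiveCompactificationProofs`),
  `charlesSchnell_algebraicityLocus_iUnion_closed_holds` (`HodgeTheory/AlgebraicityLocusIUnionClosedProofs`),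
  `lefschetzOneOne_rational_holds` (`HodgeTheory/LefschetzOneOneHolds`, landed 2026-08-16) — so
  `ClosingFacts` became (gen 3) `weilFamilyReach_hyperbolic ∧ deligne_globalInvariantCycles`; gen 4 (above) drops the
  second conjunct too. Modulo print theorems the line's theorem `WeilAlgebraicAll 3 3` hinges on STUB 1 + Bloch `(8,4)` +
  `weilFamilyReach_hyperbolic`.

## What changed from gen 1 (planner, commit 020795f1ce47, sha 0a9100e5…) — wave 1 of lead a3

* VOCABULARY LANDED: `schoenPrym`, `IsSchoenPrymPair` (+ `comp_self_of_isSchoenPrymPair`, proved), `symHyp`, `pow4`,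
  `PrymSpread` in `Theorems/PadicSemiregularLiftHodgeAbelianVarietiesPrymDefs.lean` (p111243); `SemiregularSchoenSeed`
  (gen 2) + the proved composition `prymSpread_of_seed_of_bloch` in `…PrymSeedDefs.lean` (p120073) — IMPORTED, no
  longer declared here.
* STUB 1 RESHAPED (one conjunct added): the seed `i : Z ↪ P` must be a REGULAR IMMERSION OF CODIMENSION 4
  (`Literature.AlgebraicGeometry.HodgeTheory.IsRegularImmersionOfCodim i 4`, local complete intersection) — the printed
  hypothesis of Bloch's theorem, which the intended witness `Z₀` must satisfy anyway for Bloch to fire.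
* STUB 2 = THE NAMED FACT: `∀ n p, Literature.AlgebraicGeometry.HodgeTheory.BlochSemiregularSpread n p` (Bloch 1972
  (7.4)–(7.5) / Buchweitz–Flenner 2003 Thm 5.2 at `I = {p}` / Voisin LNM 1594 L7 Thm 2.4, class-level anchored lci form,
  `HodgeTheory/BlochSemiregularSpread.lean`, landed 2026-08-16; wave-1 verdict `stub-misstated` for the gen-1 lci-free
  copy, which is HC-true but not print-true; outright cells `p = 0`, `p = n`, `n < p` PROVED:
  `HodgeTheory/BlochSemiregularSpreadCells.lean`, p112702).
* STUB 3 RESHAPED INTO ITS PRINT INPUTS: `stub_spreadClosing : SpreadClosing` is now PROVED here from the new stub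
  `stub_closingFacts : ClosingFacts` (= the conjunction of FIVE named facts of the tree, all print theorems:
  `weilFamilyReach_hyperbolic` (Deligne LNM 900 proof of 4.8 + Landherr + van Geemen 5.2–5.11; NEW, p116216),
  `deligne_globalInvariantCycles` (Hodge II 4.1.1), `Hironaka1964_smoothCompactification`,
  `charlesSchnell_algebraicityLocus_iUnion_closed` (CDK), `lefschetzOneOne_rational`) by the LANDED reduction
  `spreadClosing_of_weilFamilyReach` (`Theorems/…StubSpreadClosing.lean`, p116217: W-engine from a flat Weil section,
  Baire spreading over the ⋃-closed algebraicity locus, one-class-suffices in the Weil plane, isogeny descent — all proved).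
* STUB 4 PROVED UNCONDITIONALLY: `Stubs.Descend.stub_descend` (`Theorems/…StubDescendPrym.lean`, p118378; the
  partner-surface fact `exists_weilTypeSurface_prod_isHyperbolicWeilType_all` DISCHARGED for every `d`, Schoen's transfer
  `Schoen1998_…_all_holds`), all `n ≥ 2`, `d ≥ 1` — no `sorry` left on the DESCENDING rung.
* STUBS 5–6 (parked complement edges) DECOMPOSED to sharp residuals (landed, conditional):
  `Stubs.WeilSectorOffReach.weilSectorOffReach_of_markman_of_residual` (p119566: the edge ⟺ the residual
  "split Weil `2n`-folds, `n ≥ 4`, off the cell `(4,3)`" modulo `Markman2025_weilClasses_algebraic_abelianFourfold`;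
  `Stubs.WeilAlgebraicSplitHyperplane 4 3` is idle in it) and
  `Stubs.WeilSectorSufficesCM.weilSectorSuffices_of_andre_of_nonCM` (p119954: the edge ⟸ Moonen–Zarhin dim ≤ 5 fact +
  `CMWeil[]` + André 1992 `AndreSplitWeil[]` + the OPEN CM-to-general transport in dim ≥ 6; `HomPullback[]`,
  `nonempty_hodgeModel` discharged). They stay verbatim (shared items of the e-step line).

So the skeleton's `sorry`s are now: STUB 1 (OPEN — the bet), STUB 2 (ONE cell `BlochSemiregularSpread 8 4` of the named fact,
gen 4), STUB 3' `stub_closingFacts` (ONE named fact `weilFamilyReach_hyperbolic`, gen 4), STUBS 5–6 (parked, HC-hard edges). Modulo PRINT THEOREMS ONLY, the line's new theorem `WeilAlgebraicAll 3 3`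
(every `ℚ(√-3)` Weil sixfold) hinges on STUB 1 ALONE: `weilAlgebraicAll_three_three_of`.

## The line (crux idea `prym-canonical-z3-split-seeds`, crux-ideate r2 ideator 4; triage r2: 2 × pass)

SCHOEN–PRYM SEEDS, TRANSPORTED ACROSS FOUR NORMAL DIRECTIONS. For an étale cyclic triple cover
`C₁₃ → C₅` of a genus-5 curve (deck automorphism `α` of order 3, fixed-point free) the Prym
`P = (ker(𝟙 + α_* + α_*²))⁰ ⊂ J(C₁₃)` is an abelian EIGHTFOLD with `ℤ[ζ₃]`-multiplication
(`ψ₀ := 𝟙 + 2α_P`, `ψ₀² = -3`: `K = ℚ(√-3)` of signature `(4,4)`), SPLIT (= hyperbolic, Witt index 4;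
TRIAGE r2-1 lattice computation: the Prym form is `⊥(K aᵢ ⊕ K bᵢ)` with `K aᵢ` isotropic) and
HODGE-GENERIC (TRIAGE r2-2: the compact-type degeneration `C₅ ⇝ C₄ ∪ E` exhibits `P₆ × (E ⊗ ℤ[ζ₃])` in the
closure of the Prym locus, which therefore misses the only special subvariety `U(4,3) × U(0,1)` of dimension
`≥ 12`), and the Prym map `R₅[3] → 𝒜₈^{(1⁴,3⁴)}` is generically finite (TRIAGE r2-2: the codifferential
`H⁰(ω)_ζ ⊗ H⁰(ω)_{ζ²} → H⁰(C₅, ω²)` is onto at an explicit `(ℤ/3)²`-curve), so the PRYM LOCUS `𝒫` is a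
12-dimensional subvariety of the 16-dimensional split `ℚ(√-3)` Weil-eightfold component `𝒮`: an anchor locus
of CODIMENSION 4 (products: 6; CM points: 16). SEEDS ARE IN PRINT: Schoen, Compositio 65 (1988) Thm 2.0
(simplicity automatic for `r = 0`) + Cor. 3.1 (p. 24: "`U' ⊂ H^h(B,ℚ)` is generated by fundamental classes of
codimension-`h/2` algebraic cycles") at `(q, m, r) = (5, 3, 0)`: the locus `Nm⁻¹|K_{C₅}| ∩ W₈ ⊂ S⁸C₁₃` lies
over the simply connected `ℙ⁴ = |K_{C₅}|`, hence SPLITS in the étale cover defined by the 3-torsion point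
into three components whose Abel–Prym images `Z₀, Z₁, Z₂ ⊂ P` (reduced irreducible 4-folds, permuted by
`α`, `α^*` acting on the Weil plane by `ζ₃^{±8} ≠ 1`) have classes `[Zⱼ] = c·θ⁴ + wⱼ` with `w₀, w₁` SPANNING
the Weil plane — so the Weil classes are algebraic on EVERY point of `𝒫` (sibling fact in the tree:
`Schoen1988_cyclicPrym_weilClasses_algebraic_degreeSix`, the `ℤ/6`-over-genus-5 case, same component).
THE MOVE (the line's single bet, F2/F3 of the card): `Z₀ ⊂ P` is BLOCH-SEMIREGULAR
(`π_{Z₀} : H¹(Z₀, 𝒩) → H⁵(P, Ω³)` injective — the `σ₃ = σ_{n-1}` component, as Disproof §11 F14–15 demand),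
so by Bloch's semi-regularity theorem (Invent. Math. 17 (1972); in the held exposition Voisin, LNM 1594 Lecture 7,
Thm 2.3–2.4, pp. 154–155; Buchweitz–Flenner 2003 Thm 5.2 embedded form) the
relative Hilbert scheme of the universal split family `𝒳 → 𝒮` is smooth over `𝒮` at `[Z₀]` (the class
`c θ⁴ + w₀` stays Hodge on ALL of `𝒮`), `Z₀` spreads over a neighbourhood `U` of the Prym point, the Weil
classes are algebraic on `U` (θ⁴ algebraic, `(𝟙 + φ)^*`-eigen-trick separates the two Weil lines since
`(1+i√3)⁸ ≠ (1-i√3)⁸`), hence on all of `𝒮` (algebraicity locus = countable union of closed subvarieties,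
Baire), hence on every split `ℚ(√-3)` eightfold (Landherr + Hecke reach + isogeny descent): this is
`Stubs.WeilAlgebraicSplitHyperplane 4 3` — OPEN for every `K` in dimension 8 — and by DESCENDING
(Schoen 1998 §10) every `ℚ(√-3)` Weil SIXFOLD of every discriminant (`WeilAlgebraicAll 3 3`; the named open
case for `d = 3`, arXiv:2603.20268 p. 3; Disproof §3 `not_of_not_weilSixfolds`).

## Shape: six registered stubs, composition by pure logic

* `stub_semiregularSchoenSeed : SemiregularSchoenSeed` — THE BET (open, crux-grade, XL): a genus-5
  `ℤ/3` Schoen–Prym pair `(P, ψ₀)`, split for a `K`-symmetrised hyperplane class `h_K`, carries an integral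
  closed codimension-4 local complete intersection `Z ↪ P` (`IsRegularImmersionOfCodim i 4`, gen 2) which is
  Bloch-semiregular (the tree's REAL carrier
  `HodgeTheory.IsBlochSemiregular i 8 4`, `BlochSemiregularityMapReal.lean`: surjectivity of Bloch's pairing
  map, i.e. injectivity of `π_Z` by Serre duality) and supports the rational class `w + c·h_K⁴`, `w ≠ 0` Weil.
* `stub_blochSpread : Literature.AlgebraicGeometry.HodgeTheory.BlochSemiregularSpread 8 4` (gen 4; gen 2–3: `∀ n p`) —
  BLOCH 1972 / BF Thm 5.2, the tree's NAMED FACT (landed 2026-08-16, `HodgeTheory/BlochSemiregularSpread.lean`, lci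
  form): a Bloch-semiregular lci seed supporting the value at `s₀` of a fibrewise-Hodge global class `W` of a
  smooth projective family forces `W|_t` algebraic on an open neighbourhood of `s₀`. (GEN 2 RESHAPE, lead a3:
  the gen-1 local copy without the lci clause is replaced by the Literature def; the lci clause
  `IsRegularImmersionOfCodim i 4` joins the seed.)
* `stub_spreadClosing : PrymSpread → Stubs.WeilAlgebraicSplitHyperplane 4 3` — PRINT INFRASTRUCTURE, PROVED modulo
  `stub_closingFacts` (gen 4: the single named fact `weilFamilyReach_hyperbolic`): PEL Shimura family of the split
  `(4,4)` `ℚ(√-3)` component through `(P, K, h_K)`; global classes by Leray + `deligne1968_invariantClass_fromTotalSpace`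
  (THEOREM); `charlesSchnell_algebraicityLocus_iUnion_closed` (THEOREM) + `TropicalCuspLift.BaireSpreading` (PROVED);
  reach by Landherr + transitivity of Hecke on `π₀`; isogeny descent (`WeilClassesIsogenyDescent`, PROVED); the eigen-trick.
* `stub_descend` — VERBATIM the e-step gen-3 stub (true in print; conditional reduction LANDED p95682).
* `stub_weilSectorOffReach` — PARKED COMPLEMENT: the rest of the imaginary-quadratic Weil sector given the two
  `ℚ(√-3)` statements this line proves (shared target of `HeckePrymWeil` (`K = ℚ(√-p)`, `p ≥ 7`), of the
  e-step E-tower (split, all `d`) and of `TropicalCuspLift`).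
* `stub_weilSectorSuffices` — VERBATIM the e-step gen-3 complement edge (parked; partials LANDED p97654).

PROVED glue: `prymSpread_of_seed_of_bloch`, `weilAlgebraicSplitHyperplane_four_three_of`,
`weilAlgebraicAll_three_three_of` (THE LINE'S NEW THEOREM), `weilClassesAlgebraic_of`,
`HodgeAbelianVarieties_of_stubs : S₁ → S₂ → S₃ → S₄ → S₅ → S₆ → crux` (pure logic) and
`HodgeAbelianVarieties_of : crux` BY NAME, fed with the six sorried stubs (gen-3 convention of this crux).

## Typing decisions (triage r2 sharpenings (1)–(3) honoured)

(1) S1 is not a crux stub: Schoen's theorem enters as the CLASS CLAUSE of the seed (`w + c h_K⁴` supported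
on `Z`, `w ≠ 0` Weil) — the intended witness is Schoen's `Z₀`, whose class is in print; the general-form
Literature fact (Patel–Zhang Thm 1.2 / Schoen Cor 3.1 for `ℤ/3` over genus 5) is requested separately.
(2) The transport is NOT variational Hodge in costume: the open stub is the semiregularity of ONE subscheme of
ONE Prym (real `T¹ = H¹(𝒩)` through the tree's Bloch pairing map), Bloch's theorem is its own print-level
stub with the real `IsBlochSemiregular` as hypothesis, and the conclusion reached before closing is
algebraicity on an OPEN SET of the base, not on the base. (3) No `h = 0` vacuity: every Weil-type statement
is over the tree's `K`-symmetrised hyperplane class `3·e^*a + ψ₀^*(e^*a)`, `a ≠ 0` rational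
(`Stubs.WeilAlgebraicSplitHyperplane`, LANDED p94589; `HeckePrymWeil.HyperbolicEightfoldsSqrtMinus7` shape).
VACUITY AUDIT of `PrymSpread`'s inner `∀`-clause: the trivial family over `Spec ℂ` (and the universal split
family) satisfy every hypothesis, so the clause always demands at least "the seed class is algebraic on
`P`"; rationality of `w + c h_K⁴` and hyperbolicity of `(P, ψ₀, h_K)` are conjuncts precisely so that an
anchored family with the required global classes EXISTS (closing is never fed a vacuous antecedent).
JUNK AUDIT of the seed: `Z = ∅`, points, curves fail the class clause (`H⁸_Z(P) = 0` for
`dim_ℝ Z < 8`); `Z = P` fails the codimension clause; a non-lci integral `Z` passing the surjectivity test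
is the one residual (Bloch's theorem then does not fire; the stub stays HC-true) — lci has no carrier yet.

## Disproof used (cdisprove `Disproof.lean` cycles 1–4, NO KILL; `## Targets`: nothing on Prym anchors or
subvariety seeds; landed `Negative/{ExtremeCodimensions, KillTransfer, InnerFormSeedsTyping,
StubWeilSectorSeedsFalseOf}` — none concerns this line; `ExtremeCodimensions` IMPORTED for the consistency
`example`)
* §1 `iff_hodgeConjecture_restricted`: the line attacks statements BELOW the crux (split eightfolds, all
  sixfolds for `d = 3`) and names its complement edges (`stub_weilSectorOffReach`, `stub_weilSectorSuffices`).
* §3 `weilItems_of` / `not_of_not_weilSixfolds` / `hodgeAbelianVarieties_iff_deepMiddle`: target = `p = 3` on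
  sixfolds via `p = 4` on eightfolds (deep middle, `2 ≤ p ≤ dim/2`).
* §4 `hodgeAbelianVarieties_false_without_proper` / `_false_without_groupLaw`: the line USES properness and
  the group law at `stub_semiregularSchoenSeed` (Prym = identity component of a kernel in a Jacobian; Bloch
  needs a smooth PROJECTIVE ambient) and at `stub_spreadClosing` (abelian schemes over a Shimura base).
  `not_allHodgeTypeClassesAlgebraicOnAbelianVarieties`: every conclusion is about RATIONAL `(n,n)` classes
  (`WeilAlgebraicFor` carries `IsRationalClass`). `not_integralSaturationOnAbelianVarieties` (EdGFS 2025):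
  `ℚ`/`ℂ`-coefficients only (Schoen's `[Zⱼ]` carries the `1/3` of the splitting; `c ∈ ℂ`).
* §5 `kaehler_analogue_fails` (Voisin 2002): deformation only along the ALGEBRAIC split family; Pryms exist
  only over projective curves.
* §8 `not_hodgeRingDivisorGeneratedOnAbelianVarieties`: the seeds are not divisor polynomials — `w ≠ 0` is a
  conjunct, certified by the `ζ₃`-character in the intended witness.
* §11 F14–15 (`{0,1}`-semiregular no-go, `seed_dichotomy`) and the landed `StubWeilSectorSeedsFalseOf`: NOT
  MET — the certificate here is Bloch's `π_Z`, the `σ_{p-1} = σ₃` component for a codimension-4 SUBSCHEME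
  (BF Prop. 8.2), never `(σ₀, σ₁)`; and the seed predicate is the REAL `IsBlochSemiregular`, not an
  `∃ D : SubschemeSemiregularityData` (the junk-inhabitable shape flagged in `## Targets`, cycle 1–2 note).
* Round-1 autopsy (`Lines/a2-reseat-all-entries-dead.md` (iv)): G-rigidity (e-step Thm A) is NOT required by
  Bloch's theorem for subschemes; the certificate is `σ_{n-1}`; the class equation is solved by a single
  integral subvariety given in print (no gallery, no pairwise non-transversality).
* `ledger negatives --problem HodgeConjecture` (DerivedTorelliFermat, ELineConnectivity): no contact.
-/
set_option linter.dupNamespace false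

noncomputable section

open CategoryTheory AlgebraicGeometry
open Literature.AlgebraicGeometry Literature.AlgebraicGeometry.Motives
  Literature.AlgebraicGeometry.HodgeTheory Literature.Geometry.Kaehler

namespace Summit.HodgeConjecture.HodgeConjecture.Cruxes.HodgeAbelianVarieties.PrymCanonicalZ3SplitSeeds

open Summit.HodgeConjecture.HodgeConjecture.Cruxes.HodgeAbelianVarieties.EStepSecantInduction

/-! ### Vocabulary: IMPORTED (`…PrymDefs`, `…PrymSeedDefs`): `schoenPrym`, `IsSchoenPrymPair`,
`comp_self_of_isSchoenPrymPair`, `symHyp`, `pow4`, `SemiregularSchoenSeed` (gen 2), `PrymSpread`,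
`prymSpread_of_seed_of_bloch`; the Res-notation is re-declared locally. -/

local notation3 (prettyPrint := false) "Res[" f ", " s ", " k ", " A "]" =>
  complexBetti.map (Motives.fiberι f s) k A

/-- The statement of STUB 3: **spread at one Schoen–Prym point closes the split `ℚ(√-3)` eightfold sector**
(`Stubs.WeilAlgebraicSplitHyperplane 4 3`, LANDED vocabulary p94589). -/
def SpreadClosing : Prop := PrymSpread → Stubs.WeilAlgebraicSplitHyperplane 4 3

/-- The statement of STUB 4 (= the e-step line's registered gen-3 `stub_descend`, byte-identical, so that the
two lines share ONE item and its landed conditional reduction p95682): DESCENDING, uniformly in `n`. -/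
def Descend : Prop :=
  ∀ n d : ℕ, 2 ≤ n → 0 < d → Stubs.WeilAlgebraicSplitHyperplane (n + 1) d → WeilAlgebraicAll n d

/-- The statement of STUB 5 (PARKED COMPLEMENT): the imaginary-quadratic Weil sector
`TropicalCuspLift.WeilClassesAlgebraic` (stmt-HodgeConjecture-2522: all `K = ℚ(√-d)`, all `2n ≥ 4`)
GIVEN the two `ℚ(√-3)` statements this line proves (all sixfolds, split eightfolds). -/
def WeilSectorOffReach : Prop :=
  WeilAlgebraicAll 3 3 → Stubs.WeilAlgebraicSplitHyperplane 4 3 →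
    Summit.HodgeConjecture.HodgeConjecture.Theses.TropicalCuspLift.WeilClassesAlgebraic

/-- The statement of STUB 6 (= the e-step line's registered gen-3 `stub_weilSectorSuffices`, byte-identical;
PARKED COMPLEMENT): the imaginary-quadratic Weil sector implies the crux. -/
def WeilSectorSuffices : Prop :=
  Summit.HodgeConjecture.HodgeConjecture.Theses.TropicalCuspLift.WeilClassesAlgebraic →
    Summit.HodgeConjecture.HodgeConjecture.Theses.PadicSemiregularLift.HodgeAbelianVarieties

/-! ### The six registered stubs -/

/-- STUB 1 (XL, OPEN — THE LINE'S BET and its hardest stub; the lead should hold it) — **a Bloch-semiregular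
Schoen seed on a split genus-5 `ℤ/3`-Prym eightfold**: `SemiregularSchoenSeed`. Why plausibly true: the
anchor side is a theorem (Schoen 1988 Thm 2.0 + Cor 3.1 at `(q,m,r) = (5,3,0)`: `cl(Z₀) = c θ⁴ + w₀`,
`w₀ ≠ 0`; `θ` is `ψ₀`-compatible, `h_K = 6mθ` for the embedding by `|mθ|`; split type and Hodge-genericity
checked by both triagers), so (b) holds for `Z = Z₀` at every Prym point; (a) is the honest open question:
`Z₀ = W₈(C₁₃) ∩ P'` is a CLEAN EXCESS intersection (`8 + 8 - 13 = 3 < 4`, excess bundle `ν^*𝒪_{ℙ⁴}(1)`,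
`N_{Z₀/S⁸C̃} = ν^*Ω_{ℙ⁴}(1)`, `ν : Z₀ → |K_{C₅}| ≅ ℙ⁴` finite of degree `3⁷` branched over the dual
hypersurface of the canonical curve — TRIAGE r2-1 (c)), so `𝒩_{Z₀/P}`, `H¹(𝒩)` and Bloch's `π` are
computable on `S⁸C₁₃` (Macdonald) at one explicit cover. Why it might fail (recorded prior of TRIAGE r2-2):
Brill–Noether-type loci are RIGID (the Abel–Jacobi curve is obstructed off `M_g` although its class stays
Hodge; Gauss image of `Z₀` = the `ℙ³` of the Prym-canonical points of `D`, so `(P, Z₀)` plausibly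
remembers the cover and `ob` could be injective on the 4 normal directions, `dim ker π ≥ 4`). DECISION
ORDER for the lead: F2 first (is `im(H⁰(N_{Z₀/𝒜}) → T_{[P]}𝒮)` equal to `T𝒫`? — linear algebra on
`𝒩_{Z₀/P}` via the clean-intersection sequence), then F3 (`ker π_{Z₀} = 0`), at the `(ℤ/3)²`-curve
`t₁³ = (x-a₁)(x-a₂)²Πᵢ(x-cᵢ)`, `t₂³ = (x-b₁)(x-b₂)²Πᵢ(x-cᵢ)` of TRIAGE r2-2 (b); a negative F2 kills the
SUBVARIETY witness (other `Z`, or the BF sheaf version of STUB 2, remain admissible witnesses of this `∃`);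
lci-ness of `Z₀` needs `h⁰ ≡ 1` along `Z̃₀` (else work with `Z̃₀ → P`). Honours Disproof §4 (proper +
group law used HERE), §8 (`w ≠ 0`), §11 (`σ₃`, real carrier). Sources: Schoen1988HodgeWeil Thm 2.0,
Lemma 2.6, Cor 3.1; Bloch1972Semiregularity; BuchweitzFlenner2003 (8.1)–Prop 8.2; vanGeemen1994HodgeAV §7;
Faber 1988 (Math. Z. 199); LangeOrtega2011 (Prym map of cyclic triple covers); Debarre 1995 (minimal classes,
the rigidity prior). -/
theorem stub_semiregularSchoenSeed : SemiregularSchoenSeed := by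
  sorry

/-- STUB 2 (L; TRUE IN PRINT — BLOCH'S SEMIREGULARITY THEOREM for lci seeds, anchored, class level) — GEN 4: the
single consumed cell `Literature.AlgebraicGeometry.HodgeTheory.BlochSemiregularSpread 8 4` of the tree's NAMED FACT
(the cells `p ≤ 1 ∨ n ≤ 3 ∨ n ≤ p + 1` are theorems, `blochSpread_cells_holds`, p122864; gen-2
reshape: the statement IS the Literature def landed 2026-08-16 in `HodgeTheory/BlochSemiregularSpread.lean`,
Bloch 1972 Thm (7.4)–(7.5) / BF 2003 Thm 5.2 at `I = {p}` / Voisin LNM 1594 L7 Thm 2.4, with the printed lci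
hypothesis `IsRegularImmersionOfCodim i p`; no `_holds` in the tree: closing it = proving Bloch's theorem on the
real carriers — relative Hilbert schemes, `T²`, cycle classes of flat families —, so the line is CONDITIONAL on
this print theorem exactly as the card says).
Why it is the right tool here (and not the tree's `{0,1}`-semiregular VHC facts `BuchweitzFlenner2003_…` /
`Perry2026_…`): Disproof §11 F14–15 — a Weil class is invisible to `(σ₀, σ₁)`; Bloch's `π_Z` for a
codimension-4 subscheme IS the `σ₃` component (BF Prop 8.2). ROLE: consumed at `(n,p) = (8,4)` only
(`prymSpread_of_seed_of_bloch`). Sources: Bloch1972Semiregularity (via vanGeemen1994HodgeAV = LNM 1594, Voisin Lecture 7 Thm 2.3–2.4,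
pp. 150, 154–155: "the only general criterion … cannot be checked in general"); BuchweitzFlenner2003 Thm 5.2,
§8; BandieraLepriManetti2023 §1; Pridham arXiv:1208.3111 (derived form); VoisinHodgeII2003 §3.3.1 (relative
Hilbert schemes), Fulton1998 §10.1/§19 (cycle classes in families). -/
theorem stub_blochSpread : Literature.AlgebraicGeometry.HodgeTheory.BlochSemiregularSpread 8 4 := by
  sorry

/-- **`ClosingFacts`** — the statement of the RESHAPED STUB 3 (gen 4): the ONE NAMED FACT of the tree still needed
and unproved in Lean, from which the landed reduction `spreadClosing_of_weilFamilyReach_hyperbolic` (p123553; = p116217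
with the W-engine in Leray form fed by the theorem `deligne1968_invariantClass_fromTotalSpace_holds`, and with
`charlesSchnell_algebraicityLocus_iUnion_closed_holds`, `lefschetzOneOne_rational_holds`) proves `SpreadClosing`:
`weilFamilyReach_hyperbolic` — Deligne's polarized Weil family through a hyperbolic `2n`-fold with a relative polarization
class, flat Weil sections and REACH of every hyperbolic `(A, φ)` up to `K`-isogeny (Deligne LNM 900, proof of Thm 4.8 with
Prop 4.4; van Geemen LNM 1594 5.2–5.4, 5.8–5.11; Landherr 1936; Mumford GIT 7.9–7.10; p116216; in-tree reductions
`…_of_polarizedWeilSystem ← _of_unitaryMonodromyFamily ← _of_construction ← _of_levelConstruction`, residual = the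
level-`n` universal PEL abelian scheme with `𝒪_K`-action, no moduli of abelian varieties in the tree). Gen 2 had five
conjuncts, gen 3 two; `deligne_globalInvariantCycles` (Hodge II 4.1.1) left the line in gen 4. -/
def ClosingFacts : Prop :=
  Literature.AlgebraicGeometry.HodgeTheory.weilFamilyReach_hyperbolic

/-- STUB 3' (gen 4; PRINT — ONE named fact, see `ClosingFacts`; gen 2 had five, gen 3 two; replaces the gen-1 XL
formal stub `stub_spreadClosing`, which is PROVED from it below). Closing it = discharging
`weilFamilyReach_hyperbolic` (PEL moduli + Landherr; no moduli of abelian varieties in the tree) — the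
literature-provers' debt queue, not specific to this line. -/
theorem stub_closingFacts : ClosingFacts := by
  sorry

/-- STUB 3 of gen 1 — `SpreadClosing : PrymSpread → Stubs.WeilAlgebraicSplitHyperplane 4 3` — is PROVED (gen 4)
from `stub_closingFacts` by the landed reduction `spreadClosing_of_weilFamilyReach_hyperbolic`
(`Theorems/…StubClosingFacts.lean`, p123553, wave 2 worker B; gen 2: `spreadClosing_of_weilFamilyReach`, p116217, W3):
(i) Deligne's Weil family through `(P, ψ₀, h_K)` with its relative polarization class `H` and the flat Weil
section `σ` through `w`, reaching a fibre `K`-isogenous to any hyperbolic `(A, φ)` (fact (1)); (ii) the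
W-engine `stub_globalClassOfSection` + `stub_rationalAlongSection` (Leray + fixed part + Hironaka: facts
(2)–(3)) turn `σ` and `σ + c·H⁴` into global classes fibrewise rational of type `(4,4)`; (iii) the
`∀`-clause of `PrymSpread` gives a non-empty open set of algebraicity, spread to every fibre by
`map_fiberι_mem_algebraicClasses_of_isOpen` (fact (4) + Baire, proved); (iv) `H|_t⁴` is algebraic
(Lefschetz `(1,1)`, fact (5), + cup products on an abelian variety), so the transport of `w` is a NON-ZERO
algebraic class of the Weil plane of the isogenous fibre, and ONE such class suffices
(`weilClassesOf_le_algebraicClasses_iff_exists_ne_zero_of_dim_eq`, proved); (v) isogeny descent to `A`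
(`mem_algebraicClasses_of_isogeny_of_mem_weilClassesOf`, proved). Honours Disproof §4 (abelian schemes: proper
+ group law), §5 (algebraic family only). -/
theorem stub_spreadClosing : SpreadClosing :=
  spreadClosing_of_weilFamilyReach_hyperbolic stub_closingFacts

/-- STUB 4 (DESCENDING, all `n ≥ 2`, `d ≥ 1`) — **PROVED UNCONDITIONALLY** in wave 1 (worker W4):
`Stubs.Descend.stub_descend` (`Theorems/PadicSemiregularLiftHodgeAbelianVarietiesStubDescendPrym.lean`,
p118378): the p95682 assembly `stub_descend_of_partner_of_schoen` fed with the DISCHARGED partner-surface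
fact `exists_weilTypeSurface_prod_isHyperbolicWeilType_all_holds` (Markman §11.5 Step 1 in the Weil-plane
typing, every `d`) and Schoen's transfer `Schoen1998_weilClasses_algebraic_of_prod_surface_all_holds` (§10,
proved on the real Gysin maps). ROLE: consumed at `(n, d) = (3, 3)` only (`weilAlgebraicAll_three_three_of`;
`Stubs.Descend.descend_three_three`). Sources: Schoen1998HodgeWeilAddendum §10; Koike2004WeilHodge Rem 2.1;
Markman2025SurveySecant §11.5. -/
theorem stub_descend :
    ∀ n d : ℕ, 2 ≤ n → 0 < d → Stubs.WeilAlgebraicSplitHyperplane (n + 1) d → WeilAlgebraicAll n d :=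
  Stubs.Descend.stub_descend

/-- STUB 5 (XXL, OPEN — PARKED COMPLEMENT, NOT attacked by this line; sharing candidate) —
`WeilSectorOffReach`: the imaginary-quadratic Weil sector `TropicalCuspLift.WeilClassesAlgebraic`
(stmt-HodgeConjecture-2522) from the two `ℚ(√-3)` statements of this line. WAVE 1 DECOMPOSITION (worker W5,
`Theorems/…StubWeilSectorOffReach.lean`, p119566): modulo the KNOWN fact
`Markman2025_weilClasses_algebraic_abelianFourfold` the edge is EQUIVALENT to the residual
`∀ n d, 4 ≤ n → 0 < d → (n ≠ 4 ∨ d ≠ 3) → Stubs.WeilAlgebraicSplitHyperplane n d` (split Weil `2n`-folds,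
`n ≥ 4`, off the cell `(4,3)` — the dead e-step line's E-tower statement; typed items meeting it:
`TropicalCuspLift.WeilSixfolds` = row `n = 4` after Descend, `HeckePrymWeil.HyperbolicEightfoldsSqrtMinus7` ⟹
cell `(4,7)`), `weilSectorOffReach_of_markman_of_residual`; `Stubs.WeilAlgebraicSplitHyperplane 4 3` is idle in
the edge once `WeilAlgebraicAll 3 3` is granted. HONEST STATUS: the Prym mechanism is confined to
`K = ℚ(√-3)` (BarrierNotesIdeator4Round2 §B1). Implied by the crux, hence irrefutable unless HC fails.
Sources: Weil1977HodgeRing; vanGeemen1994HodgeAV Thm 4.11; Markman2025SecantWeil; WeilLocusSixfolds2026. -/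
theorem stub_weilSectorOffReach : WeilSectorOffReach := by
  sorry

/-- STUB 6 (XXL, OPEN — PARKED COMPLEMENT; VERBATIM the e-step gen-3 `stub_weilSectorSuffices`, shared
item; partials p97654) — the imaginary-quadratic Weil sector implies the crux. WAVE 1 DECOMPOSITION (worker
W6, `Theorems/…StubWeilSectorSufficesCM.lean`, p119954): `weilSectorSuffices_of_andre_of_nonCM` — the edge
follows from (a) `MoonenZarhin1999_hodgeClasses_abelian_dim_le_five_of_weilClassesFourfolds` (named fact),
(b) `CMWeil[]` (Weil classes for CM fields of every degree — degree `> 2` open in print), (c) `AndreSplitWeil[]`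
(André 1992, print, unformalised), (d) the CM-to-general transport
`∀ A, 6 ≤ A.dim → ¬ IsCM[A] → HodgeConjectureFor A.dim A.X` (OPEN, no mechanism in print; under (a)–(c)
also NECESSARY: `hodgeAbelianVarieties_iff_nonCM_six_le_dim`); `HomPullback[]` and `nonempty_hodgeModel` are
DISCHARGED. `= HodgeAbelianVarieties ∨ ¬ WeilClassesAlgebraic` (`weilSectorSuffices_iff`, p97654).
Sources: Andre1992CMHodge; MoonenZarhin1999; Markman2025SurveySecant Thm 1.4; Deligne1982HodgeCycles. -/
theorem stub_weilSectorSuffices : WeilSectorSuffices := by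
  sorry

/-! ### Name-keyed aliases of the stub statements (the hypotheses of the composition) -/
namespace Registered

/-- Alias of `SemiregularSchoenSeed` (gen 2, lci clause) keyed by the registered stub name. -/
abbrev stub_semiregularSchoenSeed : Prop := SemiregularSchoenSeed
/-- Alias of `Literature.AlgebraicGeometry.HodgeTheory.BlochSemiregularSpread 8 4` (the consumed cell of the NAMED
FACT, Bloch 1972 / BF Thm 5.2, lci form; gen 4) keyed by the registered stub name. -/
abbrev stub_blochSpread : Prop :=
  Literature.AlgebraicGeometry.HodgeTheory.BlochSemiregularSpread 8 4
/-- Alias of `ClosingFacts` (one named fact, gen 4) keyed by the registered stub name. -/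
abbrev stub_closingFacts : Prop := ClosingFacts
/-- Alias of `SpreadClosing` (gen-1 stub, PROVED from `stub_closingFacts` in gen 2). -/
abbrev stub_spreadClosing : Prop := SpreadClosing
/-- Alias of `Descend` (gen-1 stub, PROVED unconditionally p118378). -/
abbrev stub_descend : Prop := Descend
/-- Alias of `WeilSectorOffReach` keyed by the registered stub name. -/
abbrev stub_weilSectorOffReach : Prop := WeilSectorOffReach
/-- Alias of `WeilSectorSuffices` keyed by the registered stub name. -/
abbrev stub_weilSectorSuffices : Prop := WeilSectorSuffices

end Registered

/-! ### Glue (proved, no `sorry`) -/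

/-- **One named fact ⟹ `SpreadClosing`** (the landed reduction p123553, re-exported in hypothesis form). -/
theorem spreadClosing_of_closingFacts (h : ClosingFacts) : SpreadClosing :=
  spreadClosing_of_weilFamilyReach_hyperbolic h

/-- **STUB 1 + the cell `(8,4)` of Bloch ⟹ `PrymSpread`** (gen 4 form of the landed `prymSpread_of_seed_of_bloch`,
p120073, which takes `∀ n p`; same proof: unpack the seed and feed Bloch at `(n,p) = (8,4)`, `X₀ = P`,
`x = w + c h_K⁴`). -/
theorem prymSpread_of_seed_of_bloch84 (hS : SemiregularSchoenSeed)
    (hB : Literature.AlgebraicGeometry.HodgeTheory.BlochSemiregularSpread 8 4) : PrymSpread := by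
  -- adapted from `prymSpread_of_seed_of_bloch` (Theorems/…PrymSeedDefs, p120073)
  obtain ⟨P, ψ₀, e, a, Z, i, w, c, hP, ha, ha0, hhyp, hci, hreg, hint, hcod, hsr, hw, hw0, hrat, hsupp⟩ := hS
  refine ⟨P, ψ₀, e, a, w, c, hP, ha, ha0, hhyp, hw, hw0, hrat, ?_⟩
  intro 𝒳 S f s₀ e' W H hf h𝒳 hS hSm _ _ hW _ hWs₀ _
  obtain ⟨U, hU, hs₀, halg⟩ :=
    hB P.X Z i (w + c • pow4 (symHyp ψ₀ e a)) 𝒳 S f s₀ e' W hci hreg hint hcod hsr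
      ((mem_classesSupportedOn_range_iff P.X i (2 * 4) _).2 hsupp) hf h𝒳 hS hSm hW hWs₀
  exact ⟨U, hU, ⟨s₀, hs₀⟩, halg⟩

/-- **STUBS 1 + 2 + 3' ⟹ split `ℚ(√-3)` eightfolds** (`Stubs.WeilAlgebraicSplitHyperplane 4 3`; OPEN for every
`K` in dimension `8` — Markman §1.2, WeilLocusSixfolds2026 §1): the TRANSFER `C⁺ ⟹` split rung, via
`prymSpread_of_seed_of_bloch84` (gen 4 form of p120073). -/
theorem weilAlgebraicSplitHyperplane_four_three_of (h₁ : SemiregularSchoenSeed)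
    (h₂ : Literature.AlgebraicGeometry.HodgeTheory.BlochSemiregularSpread 8 4)
    (h₃ : ClosingFacts) : Stubs.WeilAlgebraicSplitHyperplane 4 3 :=
  spreadClosing_of_closingFacts h₃ (prymSpread_of_seed_of_bloch84 h₁ h₂)

/-- **THE LINE'S NEW THEOREM: every `ℚ(√-3)` Weil SIXFOLD, every discriminant** (`WeilAlgebraicAll 3 3`), now
from STUB 1 + TWO PRINT THEOREMS ONLY (Bloch at `(8,4)`; Deligne's Weil family with reach), DESCENDING being proved
(`Stubs.Descend.descend_three_three`). The non-split `ℚ(√-3)` sixfold components are the named open case,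
arXiv:2603.20268 p. 3 — split: Schoen 1998 §§11–13 / Markman Thm 1.5.1. -/
theorem weilAlgebraicAll_three_three_of (h₁ : SemiregularSchoenSeed)
    (h₂ : Literature.AlgebraicGeometry.HodgeTheory.BlochSemiregularSpread 8 4)
    (h₃ : ClosingFacts) : WeilAlgebraicAll 3 3 :=
  Stubs.Descend.descend_three_three (weilAlgebraicSplitHyperplane_four_three_of h₁ h₂ h₃)

/-- The same in the binder shape of `TropicalCuspLift.WeilSixfolds` (stmt-HodgeConjecture-2524) at `d = 3`
(dictionary `mem_weilClassesOf_iff`). -/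
theorem weilSixfolds_sqrtMinusThree_of (h₁ : SemiregularSchoenSeed)
    (h₂ : Literature.AlgebraicGeometry.HodgeTheory.BlochSemiregularSpread 8 4)
    (h₃ : ClosingFacts) :
    ∀ (A : AbelianVariety ℂ) (φ : A ⟶ A), A.dim = 2 * 3 → IsSmoothProjective (2 * 3) A.X →
      φ ≫ φ = -(3 • 𝟙 A) →
      ∀ c : complexBetti A.X (2 * 3), IsRationalClass c → IsOfHodgeType (2 * 3) A.X (2 * 3) 3 3 c →
        c ∈ weilClassesOf A φ 3 3 → c ∈ algebraicClasses A.X 3 :=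
  fun A φ hA _ hφ c hc hH hw => weilAlgebraicAll_three_three_of h₁ h₂ h₃ A φ hA hφ c hw hc hH

/-- STUBS 1, 2, 3', 5 ⟹ the tree's typed Weil target `TropicalCuspLift.WeilClassesAlgebraic` (stmt-2522). -/
theorem weilClassesAlgebraic_of (h₁ : SemiregularSchoenSeed)
    (h₂ : Literature.AlgebraicGeometry.HodgeTheory.BlochSemiregularSpread 8 4)
    (h₃ : ClosingFacts) (h₅ : WeilSectorOffReach) :
    Summit.HodgeConjecture.HodgeConjecture.Theses.TropicalCuspLift.WeilClassesAlgebraic :=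
  h₅ (weilAlgebraicAll_three_three_of h₁ h₂ h₃) (weilAlgebraicSplitHyperplane_four_three_of h₁ h₂ h₃)

/-! ### The composition: the stubs imply the crux, by name -/

/-- **The crux from the stub STATEMENTS** (pure logic, no `sorry`; the composition in hypothesis form, gen 2:
five hypotheses — STUB 4 is a theorem, gen-1 STUB 3 is derived from STUB 3'): STUB 1 (semiregular Schoen seed)
+ STUB 2 (Bloch at `(8,4)`) give `PrymSpread`; STUB 3' (one print fact, gen 4) closes the split `ℚ(√-3)` eightfold sector;
DESCENDING (proved) gives every `ℚ(√-3)` sixfold; STUB 5 is the parked edge to the whole imaginary-quadratic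
Weil sector and STUB 6 the parked edge to the crux. -/
theorem HodgeAbelianVarieties_of_stubs (h₁ : Registered.stub_semiregularSchoenSeed)
    (h₂ : Registered.stub_blochSpread) (h₃ : Registered.stub_closingFacts)
    (h₅ : Registered.stub_weilSectorOffReach) (h₆ : Registered.stub_weilSectorSuffices) :
    Summit.HodgeConjecture.HodgeConjecture.Theses.PadicSemiregularLift.HodgeAbelianVarieties :=
  h₆ (weilClassesAlgebraic_of h₁ h₂ h₃ h₅)

/-- **`HodgeAbelianVarieties_of` — the crux BY NAME from the registered stubs** (hypothesis-free form fed
with the sorried stubs, as in the crux's registered skeletons; its own term contains no `sorry`). -/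
theorem HodgeAbelianVarieties_of :
    Summit.HodgeConjecture.HodgeConjecture.Theses.PadicSemiregularLift.HodgeAbelianVarieties :=
  HodgeAbelianVarieties_of_stubs stub_semiregularSchoenSeed stub_blochSpread stub_closingFacts
    stub_weilSectorOffReach stub_weilSectorSuffices

/-- Consistency with the landed Negative lemma (p70486): what the skeleton proves is literally the summit
restricted to abelian varieties; no stub is an instance a landed Negative lemma refutes. -/
example (h₁ : SemiregularSchoenSeed) (h₂ : Literature.AlgebraicGeometry.HodgeTheory.BlochSemiregularSpread 8 4)
    (h₃ : ClosingFacts) (h₅ : WeilSectorOffReach) (h₆ : WeilSectorSuffices) :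
    ∀ A : AbelianVariety ℂ, IsSmoothProjective A.dim A.X → HodgeConjectureFor A.dim A.X :=
  Summit.HodgeConjecture.HodgeConjecture.Theorems.HodgeAbelianVarieties.Negative.iff_hodgeConjecture_restricted.1
    (HodgeAbelianVarieties_of_stubs h₁ h₂ h₃ h₅ h₆)

/-- Upper bound (sanity): the line's new theorem is an instance of the crux (Disproof §10 pattern), so no
stub on the Weil side claims more than the summit. -/
example (h : Summit.HodgeConjecture.HodgeConjecture.Theses.PadicSemiregularLift.HodgeAbelianVarieties) :
    WeilAlgebraicAll 3 3 := by
  intro A φ hA _ c _ hc hH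
  have h2 := (h A).2 3 c
  rw [hA] at h2
  exact h2 hc hH

/-- Sanity for STUB 5's decomposition: with STUBS 1, 2, 3' the `d = 3`, `n ≤ 3` cells of the Weil sector hold
modulo the fourfold fact alone (`weilClassesAlgebraic_cells_le_three_of`, p119566). -/
example (h₁ : SemiregularSchoenSeed) (h₂ : Literature.AlgebraicGeometry.HodgeTheory.BlochSemiregularSpread 8 4)
    (h₃ : ClosingFacts) (hM : Markman2025_weilClasses_algebraic_abelianFourfold) :
    ∀ n : ℕ, 2 ≤ n → n ≤ 3 → ∀ (A : AbelianVariety ℂ) (φ : A ⟶ A), A.dim = 2 * n →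
      IsSmoothProjective (2 * n) A.X → φ ≫ φ = -(3 • 𝟙 A) →
      ∀ c : complexBetti A.X (2 * n), IsRationalClass c → IsOfHodgeType (2 * n) A.X (2 * n) n n c →
        c ∈ weilClassesOf A φ n 3 → c ∈ algebraicClasses A.X n := by
  intro n h2 h3 A φ hA hs hφ c hc hH hw
  exact Stubs.WeilSectorOffReach.weilClassesAlgebraic_cells_le_three_of hM
    (weilAlgebraicAll_three_three_of h₁ h₂ h₃) n h2 h3 A φ hA hs hφ c hc hH
    (mem_weilClassesOf_iff.1 hw)

end Summit.HodgeConjecture.HodgeConjecture.Cruxes.HodgeAbelianVarieties.PrymCanonicalZ3SplitSeeds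

end
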